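import Literature.AlgebraicGeometry.Frobenioids.PerfectionFunctoriality
import HarnessLib

/-!
# [FrdI] Theorem 4.2 (i): the reduction to Frobenioids of perfect type, AT THE PERFECTIONS (S5 row T42-L03, part B)

Mochizuki, *The geometry of Frobenioids I: the general theory*, Kyushu J. Math. **62** (2008)
293–400, §4, Theorem 4.2 (i), proof p. 78 ll. 40–46 (render `paper:url-bbf705efa10f`, read on the page)
[cite: MochizukiFrdI2008, Thm. 4.2 (i) p.78]:

> "Moreover, to prove the remainder of assertion (i) [i.e., that `Ψ` preserves primary steps and
> Div-identity endomorphisms] and assertions (ii), (iii), clearly it suffices to do so after passing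
> to the perfections of the `C_i` [cf. Theorem 3.4, (iii)]; thus, for the remainder of the proof of
> Theorem 4.2, we may assume, without loss of generality, that the `C_i` are of perfect type [cf. also
> Proposition 5.5, (iii), below]."

PROOF-ONLY file (sub-DAG `plan/L1/SUBDAG-FrdI-Thm42-Thm49.md`, row `FrdI:Thm4.2(i)/T42-L03`
`PerfectWLOG`, MENU row M4b of the L1 lead's ruling R68; companion of `Thm42PerfectReduction.lean`, which
proves the formal transport principle in the shape of the named statement `FrdI.T42.PerfectWLOG`). Here:
the content of "clearly it suffices" AT THE PERFECTIONS of the tree (`PreFrobenioid.Perfection hF`,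
`Perfection.toPf`, `Perfection.ops`, seat abc-iut-L1-d9; `Perfection.map`, `map_toPf_map`, seat
abc-iut-L1-d1):
* the functor `C → C^pf` PRESERVES AND REFLECTS primary pre-steps (`isPrimaryPreStep_toPf_iff`) and
  Div-identity endomorphisms (`isDivIdentity_toPf_iff`) — `Base`, `deg_Fr` of the image of `φ` are those
  of `φ`, its perfected divisor is `Div(φ)^{1/1}` (Prop. 3.2 (i)/(ii), `baseMap_toPf`, `degFr_toPf`,
  `div_toPf`), an element of a sharp monoid is primary iff its image in the perfection is
  (`Perfection.isPrimary_of_iff`), and `Φ(A_D) → Φ(A_D)^pf` is injective for divisorial `Φ` (FrdI §0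
  p. 11, `of_injective_of_isSharp_isIntegral_isSaturated`);
* hence, since the square `toPf ⋙ G^pf = G ⋙ toPf` of Thm. 3.4 (iii) commutes on arrows ON THE NOSE
  (`map_toPf_map`), if `G^pf` preserves primary pre-steps (resp. Div-identity endomorphisms) then so
  does `G` (`isPrimaryPreStep_map_of_perfection`, `isDivIdentity_map_of_perfection`; for an equivalence
  `Ψ`, `perfectWLOG_of_equivalence`) — with no hypothesis beyond "`C_i` Frobenioids, `G` compatible
  with arrows of Frobenius type".
What is NOT here: that `C^pf` is again a Frobenioid of perfect and isotropic type (Prop. 3.2 (iii) /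
Prop. 5.5 (iii), the input the perfect-type case of Thm. 4.2 consumes — seats abc-iut-L1-d9 / S7).
Composition is diagrammatic; monoids multiplicative. No new definitions; nothing of the paper is
asserted beyond what is proved.
-/

namespace Literature.AlgebraicGeometry.Frobenioids

open CategoryTheory Opposite

namespace FrdI.T42

section AtThePerfection

universe w₁ v₁ v₁' u₁ u₁' w₂ v₂ v₂' u₂ u₂'

open PreFrobenioid PreFrobenioid.Perfection

variable {D₁ : Type u₁} [Category.{v₁} D₁] {Φ₁ : D₁ᵒᵖ ⥤ CommMonCat.{w₁}}
  {C₁ : Type u₁'} [Category.{v₁'} C₁] {F₁ : C₁ ⥤ ElemFrobenioid Φ₁}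
  {D₂ : Type u₂} [Category.{v₂} D₂] {Φ₂ : D₂ᵒᵖ ⥤ CommMonCat.{w₂}}
  {C₂ : Type u₂'} [Category.{v₂'} C₂] {F₂ : C₂ ⥤ ElemFrobenioid Φ₂}

/-- **`C → C^pf` preserves and reflects primary pre-steps** (the implicit content of "clearly it suffices to
do so after passing to the perfections", p. 78 l. 43; preservation of pre-steps is Prop. 3.2 (ii) p. 59):
`Base`, `deg_Fr` of the image of `φ` are those of `φ` and its perfected divisor is `Div(φ)^{1/1}`
(`baseMap_toPf`, `degFr_toPf`, `div_toPf`, seat abc-iut-L1-d9), and an element of a sharp monoid is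
primary iff its image in the perfection is (`Perfection.isPrimary_of_iff`).
[cite: MochizukiFrdI2008, Thm. 4.2 (i) p.78] -/
theorem isPrimaryPreStep_toPf_iff (hF₁ : IsFrobenioid F₁) {A B : C₁} (φ : A ⟶ B) :
    (ops hF₁).IsPrimaryPreStep ((toPf hF₁).map φ) ↔ PreFrobenioid.IsPrimaryPreStep F₁ φ := by
  have hsharp : IsSharp (Φ₁.obj (op (baseObj F₁ A))) :=
    (hF₁.isPreFrobenioid.isDivisorial (baseObj F₁ A)).isSharp
  change ((Hom.degFr ((toPf hF₁).map φ) = 1 ∧ IsIso (Hom.baseMap ((toPf hF₁).map φ))) ∧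
      IsPrimary (Hom.div ((toPf hF₁).map φ))) ↔
    ((PreFrobenioid.degFr F₁ φ = 1 ∧ IsIso (Base F₁ φ)) ∧ IsPrimary (Div F₁ φ))
  rw [degFr_toPf, baseMap_toPf, div_toPf, ← Frobenioids.Perfection.of_apply,
    Frobenioids.Perfection.isPrimary_of_iff hsharp]

/-- **`C → C^pf` preserves and reflects Div-identity endomorphisms** (p. 78 l. 43): `Base` of the image of
`α` is `Base(α)` (`baseMap_toPf`), the pull-back on `Φ^pf` is the perfection of the pull-back on `Φ`, and
`Φ(A_D) → Φ(A_D)^pf` is injective (`Φ` divisorial: sharp, integral, saturated — FrdI §0 p. 11).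
[cite: MochizukiFrdI2008, Thm. 4.2 (i) p.78] -/
theorem isDivIdentity_toPf_iff (hF₁ : IsFrobenioid F₁) {A : C₁} (α : A ⟶ A) :
    (ops hF₁).IsDivIdentity ((toPf hF₁).map α) ↔ PreFrobenioid.IsDivIdentity F₁ α := by
  have hD := hF₁.isPreFrobenioid.isDivisorial (baseObj F₁ A)
  change (∀ x : Frobenioids.Perfection (Φ₁.obj (op (baseObj F₁ A))),
      Frobenioids.Perfection.map (pull Φ₁ (Hom.baseMap ((toPf hF₁).map α))) x = x) ↔
    pull Φ₁ (Base F₁ α) = MonoidHom.id _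
  rw [baseMap_toPf]
  constructor
  · intro h
    ext y
    apply of_injective_of_isSharp_isIntegral_isSaturated hD.isSharp hD.isPreDivisorial.isIntegral
      hD.isPreDivisorial.isSaturated
    simpa only [Frobenioids.Perfection.of_apply, Frobenioids.Perfection.map_mk, MonoidHom.id_apply] using
      h (Frobenioids.Perfection.of _ y)
  · intro h x
    rw [h, Frobenioids.Perfection.map_id]
    rfl

/-- **Thm. 4.2 (i), reduction to the perfections — primary steps** (p. 78 ll. 40–46, "it suffices to [prove
that `Ψ` preserves primary steps] after passing to the perfections of the `C_i` [cf. Theorem 3.4, (iii)]"):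
for a functor `G : C₁ → C₂` compatible with arrows of Frobenius type (so that `G^pf : C₁^pf → C₂^pf` is
defined, with `G^pf(toPf φ) = toPf (G φ)`: `Perfection.map`, `map_toPf_map`, seat abc-iut-L1-d1), if `G^pf`
preserves primary pre-steps then so does `G`. [cite: MochizukiFrdI2008, Thm. 4.2 (i) p.78] -/
theorem isPrimaryPreStep_map_of_perfection (hF₁ : IsFrobenioid F₁) (hF₂ : IsFrobenioid F₂) {G : C₁ ⥤ C₂}
    (hG : IsFrobeniusCompatible F₁ F₂ G)
    (hpf : ∀ ⦃X Y : PreFrobenioid.Perfection hF₁⦄ (f : X ⟶ Y), (ops hF₁).IsPrimaryPreStep f →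
      (ops hF₂).IsPrimaryPreStep ((PreFrobenioid.Perfection.map (hF₁ := hF₁) (hF₂ := hF₂) hG).map f))
    ⦃A B : C₁⦄ (φ : A ⟶ B) (hφ : PreFrobenioid.IsPrimaryPreStep F₁ φ) :
    PreFrobenioid.IsPrimaryPreStep F₂ (G.map φ) := by
  rw [← isPrimaryPreStep_toPf_iff hF₂, ← PreFrobenioid.Perfection.map_toPf_map (hF₁ := hF₁) (hF₂ := hF₂) hG]
  exact hpf _ ((isPrimaryPreStep_toPf_iff hF₁ φ).mpr hφ)

/-- **Thm. 4.2 (i), reduction to the perfections — Div-identity endomorphisms** (p. 78 ll. 40–46): if `G^pf`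
preserves Div-identity endomorphisms then so does `G`. [cite: MochizukiFrdI2008, Thm. 4.2 (i) p.78] -/
theorem isDivIdentity_map_of_perfection (hF₁ : IsFrobenioid F₁) (hF₂ : IsFrobenioid F₂) {G : C₁ ⥤ C₂}
    (hG : IsFrobeniusCompatible F₁ F₂ G)
    (hpf : ∀ ⦃X : PreFrobenioid.Perfection hF₁⦄ (f : X ⟶ X), (ops hF₁).IsDivIdentity f →
      (ops hF₂).IsDivIdentity ((PreFrobenioid.Perfection.map (hF₁ := hF₁) (hF₂ := hF₂) hG).map f))
    ⦃A : C₁⦄ (α : A ⟶ A) (hα : PreFrobenioid.IsDivIdentity F₁ α) :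
    PreFrobenioid.IsDivIdentity F₂ (G.map α) := by
  rw [← isDivIdentity_toPf_iff hF₂, ← PreFrobenioid.Perfection.map_toPf_map (hF₁ := hF₁) (hF₂ := hF₂) hG]
  exact hpf _ ((isDivIdentity_toPf_iff hF₁ α).mpr hα)

/-- **T42-L03 at THE perfections, for an equivalence** (p. 78 ll. 40–46 with Thm. 3.4 (iii)): for an
equivalence `Ψ : C₁ ≌ C₂` of Frobenioids whose functor is compatible with arrows of Frobenius type, `Ψ^pf`
is the equivalence `(Perfection.map hΨ).asEquivalence` (`map_isEquivalence`, seat abc-iut-L1-d1); if it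
preserves primary pre-steps (resp. Div-identity endomorphisms) — the perfect-type case of Thm. 4.2 (i),
rows L04–L07 — then so does `Ψ`. [cite: MochizukiFrdI2008, Thm. 4.2 (i) p.78] -/
theorem perfectWLOG_of_equivalence (hF₁ : IsFrobenioid F₁) (hF₂ : IsFrobenioid F₂) (Ψ : C₁ ≌ C₂)
    (hΨ : IsFrobeniusCompatible F₁ F₂ Ψ.functor) :
    ((∀ ⦃X Y : PreFrobenioid.Perfection hF₁⦄ (f : X ⟶ Y), (ops hF₁).IsPrimaryPreStep f →
        (ops hF₂).IsPrimaryPreStep ((PreFrobenioid.Perfection.map (hF₁ := hF₁) (hF₂ := hF₂) hΨ).map f)) →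
      ∀ ⦃A B : C₁⦄ (φ : A ⟶ B), PreFrobenioid.IsPrimaryPreStep F₁ φ →
        PreFrobenioid.IsPrimaryPreStep F₂ (Ψ.functor.map φ)) ∧
    ((∀ ⦃X : PreFrobenioid.Perfection hF₁⦄ (f : X ⟶ X), (ops hF₁).IsDivIdentity f →
        (ops hF₂).IsDivIdentity ((PreFrobenioid.Perfection.map (hF₁ := hF₁) (hF₂ := hF₂) hΨ).map f)) →
      ∀ ⦃A : C₁⦄ (α : A ⟶ A), PreFrobenioid.IsDivIdentity F₁ α →
        PreFrobenioid.IsDivIdentity F₂ (Ψ.functor.map α)) :=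
  ⟨fun hpf => isPrimaryPreStep_map_of_perfection hF₁ hF₂ hΨ hpf,
    fun hpf => isDivIdentity_map_of_perfection hF₁ hF₂ hΨ hpf⟩

end AtThePerfection

end FrdI.T42

end Literature.AlgebraicGeometry.Frobenioids
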